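import Summits.Ventures.CertifiedManyBodySolver.Theorems.M3x2EdgeSplitSymReplayOutRoute
import Summits.Ventures.CertifiedManyBodySolver.Theorems.M3x2EdgeSplitSymReplayNormalWords

/-! # E5 «ORACLE CANON» — soundness core for an ARBITRARY hint oracle (pen hub-lb-sym-plan-1 g4; scratch, NOT a proposal:
registry frozen O3/O4).  Design = sym-eng-3 g2 STATUS l.1826; hint emitter + rates = sym-ref-1 g1 l.1829 (`canonPH`, `γof`, `hintOK`).

An UNVERIFIED fast twin chooses, per residual term `t = (q, u)`, a move `(γ, v)` (and a partner `(γ', v')` when it claims the class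
is zero); the VERIFIED text only (1) tests the move is licensed (`suppIn (moveWordF γ v u) frame`), (2) computes the image with the
TREE's `nfWord (moveWordF γ v u)`, (3) for a zero claim tests the partner image is the same polynomial with the opposite sign
(`polyNegEq`).  Soundness holds FOR EVERY ORACLE (a wrong oracle yields a non-cancelling image, i.e. a failing `isZero`, never a
false certificate); minimality of representatives is used nowhere (as in the tree: `canonTermA_sound`).  This file PROVES (rc 0, 0 sorries):
the per-term identity `canonTermHW_sound` (twin of SoundB `canonTermA_sound`), its sum `sum_canonTermH` (SoundC `sum_canonTerm`), the pipe
expansion `canonNFZH_expansion` + `canonNFZHUses_supp` (LocalB l.61/l.71), the OUTROUTE closing `wardD4CertGe_of_outrouteH` /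
`energyDensity_ge_of_outrouteH` (twins of OutRoute l.251/l.264 through the use-family closing `wardD4CertGe_of_expansion` fed exactly as in
`wardD4CertGe_of_facts₂ZR`, GramRShardsGrouped l.56), and the BOX form of record `canonNFZHB`/`outOKHB`/`energyDensity_ge_of_outrouteHB` with its
`_eq` lemmas under `boxLicence` (twins of OutRoute §Box-canon form).  Same hypotheses as T20a's `energyDensity_ge_of_outroute(B)` plus the
oracle; the nf/collect thirds are the tree's (`nfPoly`/`collect`/`dropZeros`) — E4's packed nf/collect composes underneath later, independently.
LANDING NOTES (engine): a Theorems copy needs the cell's module-docstring grammar, `import HarnessLib`, the `OutFactsH/HB` Prop-defs treated as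
T20a's `OutFacts/OutFactsB` are by the audit, and an `--axioms` co-read of `energyDensity_ge_of_outrouteHB`; the ORACLE ADAPTER from sym-ref-1 g1's
`Hint` (pub g1-packed/PackedCanonKernel.lean v2) is `fun w => let h := canonPH permTab (encW w); ⟨γof h.k, mkSite (−h.amin) (−h.bmin),
h.zeroWith.map fun z => (γof z.1, mkSite (−z.2.1) (−z.2.2))⟩` (its file's side, not this one's).
REV 2 (+ §RESORT, §RESORT-EXEC): the verified step `nfWord (moveWordV γ v u)` gets a second executable `nfMoveR` = the signed two-block
RE-SORT `resortNF` behind a cheap block-shape guard, with the PROVED identities `nfWord_eq_resortNF` (no contraction on block-shaped words —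
the `pnf_agree` core, in tree letters) and `blockShaped_moveWordV` (moves of normal words are block-shaped), so `canonNFZHBR = canonNFZHB`
unconditionally (`canonNFZHBR_eq`) and `energyDensity_ge_of_outrouteHBR` is the box closing rewritten.  MEASURED (e5/E5BenchR.lean, 15 296
images of 6-letter words, interpreted): tree-letter verified step 102 µs/image of which the MOVE `moveWordV` is 82 µs and `nfWord` ≈ 20 µs;
`nfMoveR` 110 µs/image (0/15 296 disagreements, guard never fails) ⇒ the re-sort is PRICE-NEUTRAL in tree letters — its value is as the
correctness core of the PACKED re-sort (E4 B3 / sym-ref-1's `sortPar`) and of any closed-form verified step; the tree-letter lever is the move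
itself (closed-form twin `moveWordZ`, e5/MoveZ.lean).  0 sorries. -/

open Literature.MathematicalPhysics.QuantumLattice
open Literature.MathematicalPhysics.QuantumLattice.HubbardWave0
open Literature.MathematicalPhysics.QuantumLattice.ThermodynamicLimit
open Literature.Probability.LatticeModels
open Literature.MathematicalPhysics.QuantumManyBody.StateRelaxation
open Summit.Ventures.CertifiedManyBodySolver.Theorems.WardSlot

namespace Summit.Ventures.CertifiedManyBodySolver.Theorems.SymReplay.E5


/-- A canon hint for one word: the move, and optionally a partner move witnessing a self-cancelling class. -/
structure HintT where
  γ : DihedralGroup 4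
  v : Site 2
  partner : Option (DihedralGroup 4 × Site 2)

/-- The validated partner: present only if its move is licensed and its image is the negated image. -/
def partnerOf (frame : List (Site 2)) (h : HintT) (u : Word) : Option (DihedralGroup 4 × Site 2) :=
  match h.partner with
  | none => none
  | some p =>
    if suppIn (moveWordF p.1 p.2 u) frame && polyNegEq (nfWord (moveWordF h.γ h.v u)) (nfWord (moveWordF p.1 p.2 u))
    then some p else none

theorem partnerOf_spec {frame : List (Site 2)} {h : HintT} {u : Word} {p : DihedralGroup 4 × Site 2}
    (hp : partnerOf frame h u = some p) :
    suppIn (moveWordF p.1 p.2 u) frame = true ∧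
      polyNegEq (nfWord (moveWordF h.γ h.v u)) (nfWord (moveWordF p.1 p.2 u)) = true := by
  unfold partnerOf at hp
  rcases hq : h.partner with _ | p'
  · rw [hq] at hp; simp at hp
  · rw [hq] at hp
    simp only at hp
    split_ifs at hp with hc
    obtain rfl := Option.some.inj hp
    simpa [Bool.and_eq_true] using hc

/-- Hinted canonical form of one term (total: an unlicensed hint leaves the term unchanged). -/
def canonTermHW (frame : List (Site 2)) (h : HintT) (t : ℚ × Word) : QPoly :=
  if suppIn (moveWordF h.γ h.v t.2) frame then
    match partnerOf frame h t.2 with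
    | some _ => []
    | none => pscale t.1 (nfWord (moveWordF h.γ h.v t.2))
  else [t]

/-- Its identification uses (none / one / two halves — the tree's `usesOfTerm` currency `IdUse`). -/
def usesOfTermHW (frame : List (Site 2)) (h : HintT) (t : ℚ × Word) : List IdUse :=
  if suppIn (moveWordF h.γ h.v t.2) frame then
    match partnerOf frame h t.2 with
    | some p => [⟨-t.1 / 2, t.2, h.γ, h.v⟩, ⟨-t.1 / 2, t.2, p.1, p.2⟩]
    | none => [⟨-t.1, t.2, h.γ, h.v⟩]
  else []

/-- With an oracle. -/
def canonTermH (frame : List (Site 2)) (oracle : Word → HintT) (t : ℚ × Word) : QPoly :=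
  canonTermHW frame (oracle t.2) t

def usesOfTermH (frame : List (Site 2)) (oracle : Word → HintT) (t : ℚ × Word) : List IdUse :=
  usesOfTermHW frame (oracle t.2) t

/-- Every use's word is the term's word. -/
theorem usesOfTermHW_u {frame : List (Site 2)} {h : HintT} {t : ℚ × Word} {e : IdUse}
    (he : e ∈ usesOfTermHW frame h t) : e.u = t.2 := by
  unfold usesOfTermHW at he
  split_ifs at he with hs
  · rcases hp : partnerOf frame h t.2 with _ | p
    · rw [hp] at he; simp at he; rw [he]
    · rw [hp] at he; simp at he
      rcases he with rfl | rfl <;> rfl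
  · simp at he

/-- **Soundness of the hinted canon on one term, for ANY hint** (twin of `canonTermA_sound`). -/
theorem canonTermHW_sound (h1 : NfFaithful) {Λ' : Finset (Site 2)} (frame : List (Site 2))
    (hfr : frame.toFinset ⊆ Λ') (h : HintT) (t : ℚ × Word) :
    ((t.1 : ℚ) : ℂ) • wordOp Λ' t.2 - polyOp Λ' (canonTermHW frame h t) =
      ((usesOfTermHW frame h t).map (useOp Λ')).sum := by
  unfold canonTermHW usesOfTermHW
  by_cases hs : suppIn (moveWordF h.γ h.v t.2) frame = true
  · have hw : polyOp Λ' (nfWord (moveWordF h.γ h.v t.2)) = wordOp Λ' (moveWord h.γ h.v t.2) := by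
      have := (h1 Λ' _ (((suppIn_iff _ _).1 hs).mono hfr)).symm
      rw [moveWordF_eq] at this ⊢; exact this
    simp only [hs, if_true]
    rcases hp : partnerOf frame h t.2 with _ | p
    · simp only [List.map_cons, List.map_nil, List.sum_cons, List.sum_nil, add_zero, useOp]
      rw [polyOp_pscale, hw]
      push_cast
      module
    · obtain ⟨hs', hneg'⟩ := partnerOf_spec hp
      have hw' : polyOp Λ' (nfWord (moveWordF p.1 p.2 t.2)) = wordOp Λ' (moveWord p.1 p.2 t.2) := by
        have := (h1 Λ' _ (((suppIn_iff _ _).1 hs').mono hfr)).symm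
        rw [moveWordF_eq] at this ⊢; exact this
      have hneg : wordOp Λ' (moveWord p.1 p.2 t.2) = -wordOp Λ' (moveWord h.γ h.v t.2) := by
        rw [← hw, ← hw']; exact polyOp_of_polyNegEq Λ' _ _ hneg'
      simp only [List.map_cons, List.map_nil, List.sum_cons, List.sum_nil, add_zero, useOp]
      rw [hneg, polyOp_nil, sub_zero]
      push_cast
      module
  · simp only [hs, Bool.false_eq_true, if_false, List.map_nil, List.sum_nil, polyOp_cons, polyOp_nil, add_zero, sub_self]

theorem canonTermH_sound (h1 : NfFaithful) {Λ' : Finset (Site 2)} (frame : List (Site 2))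
    (hfr : frame.toFinset ⊆ Λ') (oracle : Word → HintT) (t : ℚ × Word) :
    ((t.1 : ℚ) : ℂ) • wordOp Λ' t.2 - polyOp Λ' (canonTermH frame oracle t) =
      ((usesOfTermH frame oracle t).map (useOp Λ')).sum :=
  canonTermHW_sound h1 frame hfr (oracle t.2) t

/-- Twin of `sum_canonTerm`. -/
theorem sum_canonTermH (h1 : NfFaithful) {Λ' : Finset (Site 2)} (frame : List (Site 2))
    (hfr : frame.toFinset ⊆ Λ') (oracle : Word → HintT) :
    ∀ (N : QPoly), polyOp Λ' N - polyOp Λ' (N.flatMap (canonTermH frame oracle)) =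
        ((N.flatMap (usesOfTermH frame oracle)).map (useOp Λ')).sum
  | [] => by simp
  | t :: N => by
    rw [List.flatMap_cons, List.flatMap_cons, polyOp_append, polyOp_cons, List.map_append, List.sum_append,
      ← sum_canonTermH h1 frame hfr oracle N, ← canonTermH_sound h1 frame hfr oracle t]
    abel

/-- **The hinted zero-filtered pipe**: normal-order, collect, drop zeros, hinted canon (twin of `canonNFZV`). -/
def canonNFZH (frame : List (Site 2)) (oracle : Word → HintT) (p : QPoly) : QPoly :=
  (dropZeros (collect (nfPoly p))).flatMap (canonTermH frame oracle)

def canonNFZHUses (frame : List (Site 2)) (oracle : Word → HintT) (p : QPoly) : List IdUse :=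
  (dropZeros (collect (nfPoly p))).flatMap (usesOfTermH frame oracle)

/-- `p ≡ canonNFZH p` up to its identification uses (twin of `canonNFZV_expansion`, LocalB l.61). -/
theorem canonNFZH_expansion {Λ' : Finset (Site 2)} (frame : List (Site 2)) (hfr : frame.toFinset ⊆ Λ')
    (oracle : Word → HintT) (p : QPoly) (hp : PSupp p Λ') :
    polyOp Λ' p = polyOp Λ' (canonNFZH frame oracle p) + ((canonNFZHUses frame oracle p).map (useOp Λ')).sum := by
  have h := sum_canonTermH stub_nfFaithful frame hfr oracle (dropZeros (collect (nfPoly p)))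
  have hc : polyOp Λ' (dropZeros (collect (nfPoly p))) = polyOp Λ' p := by
    rw [polyOp_dropZeros, polyOp_eq_evalP, collect_eval, ← polyOp_eq_evalP, polyOp_nfPoly stub_nfFaithful _ _ hp]
  rw [canonNFZH, canonNFZHUses, ← h, hc]
  abel

/-- The use words of `canonNFZH p` are supported with `p` (twin of `canonNFZUses_supp`). -/
theorem canonNFZHUses_supp (frame : List (Site 2)) (oracle : Word → HintT) (p : QPoly) {Λ : Finset (Site 2)}
    (hp : PSupp p Λ) : ∀ e ∈ canonNFZHUses frame oracle p, SuppIn e.u Λ := by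
  intro e he
  rw [canonNFZHUses, List.mem_flatMap] at he
  obtain ⟨t, ht, he⟩ := he
  rw [usesOfTermHW_u he]
  exact hp.nfPoly.collect.dropZeros t ht

/-! ## OUTROUTE plumbing for the hinted pipe — SIGNATURES (engine item; mechanical twins of landed text) -/

/-- Per-module fact, hinted: output class `i` of the raw residual canonicalises to zero under the oracle. -/
def outOKH (K : SymCertR) (oracle : Word → HintT) (κ : Word → ℕ) (J i : ℕ) : Bool :=
  isZero (canonNFZH K.frame oracle (shareR K κ J i))

def OutFactsH (K : SymCertR) (oracle : Word → HintT) (κ : Word → ℕ) (J : ℕ) : ℕ → ℕ → Prop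
  | _, 0 => True
  | i, n + 1 => outOKH K oracle κ J i = true ∧ OutFactsH K oracle κ J (i + 1) n

/-- Facts on the output classes `i … i+n−1` expand the sum of those shares into their hinted uses. -/
theorem sum_outFactsH (K : SymCertR) (oracle : Word → HintT) (κ : Word → ℕ) (J : ℕ) {Λ' : Finset (Site 2)}
    (hFL : K.frame.toFinset ⊆ Λ') (hQ : ∀ k, PSupp (shareR K κ J k) K.frame.toFinset) :
    ∀ (n i : ℕ), OutFactsH K oracle κ J i n →
      (((List.range' i n).map (shareR K κ J)).map (polyOp Λ')).sum =
        ((((List.range' i n).map (shareR K κ J)).flatMap (canonNFZHUses K.frame oracle)).map (useOp Λ')).sum := by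
  intro n
  induction n with
  | zero => intro i _; simp
  | succ n ih =>
    intro i h
    rw [List.range'_succ, List.map_cons, List.map_cons, List.sum_cons, List.flatMap_cons, List.map_append, List.sum_append,
      ih (i + 1) h.2]
    have hexp := canonNFZH_expansion K.frame hFL oracle (shareR K κ J i) ((hQ i).mono hFL)
    have hz : polyOp Λ' (canonNFZH K.frame oracle (shareR K κ J i)) = 0 := polyOp_eq_zero_of_isZero Λ' _ h.1
    rw [hz, zero_add] at hexp
    rw [hexp]

/-- Twin of `wardD4CertGe_of_outroute` (OutRoute l.251): the use-family closing `wardD4CertGe_of_expansion` fed exactly as in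
`wardD4CertGe_of_facts₂ZR` (GramRShardsGrouped l.56) with the HINTED uses of the shares (supports: `canonNFZHUses_supp`) and no partials. -/
theorem wardD4CertGe_of_outrouteH (K : SymCertR) (hwf0 : wellFormed K.expand = true)
    (hRok : K.gramR.all (gramBlockROK K.frame) = true) (oracle : Word → HintT) (κ : Word → ℕ) (J : ℕ) (hJ : 0 < J)
    (hfacts : OutFactsH K oracle κ J 0 J) : WardD4CertGe ((symValueR K : ℚ) : ℝ) := by
  have hwfb : wellFormed K.toSymCert = true := wellFormed_toSymCert_of_expand K hwf0
  have hRok' : ∀ B ∈ K.gramR, gramBlockROK K.frame B = true := List.all_eq_true.1 hRok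
  have hsD := supp_of_gramROK K hRok
  have hQ : ∀ k, PSupp (shareR K κ J k) K.frame.toFinset := fun k => by
    rw [shareR_eq]; exact (PSupp_rawResidualR K hwfb hRok).filter _
  /- the DERIVED use family and its envelope -/
  let U := (sharesR K κ J).flatMap (canonNFZHUses K.frame oracle) ++ (K.gramR.flatMap blockUses).map negUse
  have hL : (envelope K.expand U).toList.toFinset = envelope K.expand U := Finset.toList_toFinset _
  have hFL : K.frame.toFinset ⊆ (envelope K.expand U).toList.toFinset := by
    rw [hL]; exact (subset_thicken _ 1).trans (thicken_subset_envelope K.expand U)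
  have hU : ∀ e ∈ U, SuppIn e.u K.expand.frame.toFinset := by
    intro e he
    rcases List.mem_append.1 he with he | he
    · rw [List.mem_flatMap] at he
      obtain ⟨Q, hQ', he⟩ := he
      rw [sharesR, List.mem_map] at hQ'
      obtain ⟨k, -, rfl⟩ := hQ'
      exact canonNFZHUses_supp K.frame oracle _ (hQ k) e he
    · rw [List.mem_map] at he
      obtain ⟨e', he', rfl⟩ := he
      rw [List.mem_flatMap] at he'
      obtain ⟨B, hB, he'⟩ := he'
      rw [blockUses, List.mem_flatMap] at he'
      obtain ⟨m, -, he'⟩ := he'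
      obtain ⟨t, ht, hu⟩ := polyUses_u he'
      show SuppIn e'.u K.frame.toFinset
      rw [hu]
      exact PSupp_gramBlockPolyR B (hsD B hB).1 (hsD B hB).2 t ht
  refine wardD4CertGe_of_expansion K.expand hwf0 U hU ?_
  /- the expansion -/
  have hBL : ∀ B ∈ K.gramR, (∀ s ∈ B.reps, PSupp (genPre B.moves s) (envelope K.expand U).toList.toFinset) ∧
      ∀ q ∈ genBasis B, ∀ m ∈ B.moves,
        PSupp (movePolyF m.γ m.v q) (envelope K.expand U).toList.toFinset ∧
          isZero (psub (nfPoly (movePolyF m.γ m.v q)) (pscale m.χ q)) = true := fun B hB =>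
    ⟨fun s hs => (((gramBlockROK_spec (hRok' B hB)).1 s hs).2).mono hFL,
      fun q hq m hm => ⟨((gramBlockROK_spec (hRok' B hB)).2 q hq m hm).1.mono hFL,
        ((gramBlockROK_spec (hRok' B hB)).2 q hq m hm).2⟩⟩
  have h2 := polyOp_rhsPoly_expand (envelope K.expand U).toList.toFinset K hBL
  have hsum := sum_outFactsH K oracle κ J hFL hQ J 0 hfacts
  rw [← List.range_eq_range'] at hsum
  change ((sharesR K κ J).map _).sum =
    (((sharesR K κ J).flatMap (canonNFZHUses K.frame oracle)).map (useOp (envelope K.expand U).toList.toFinset)).sum at hsum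
  rw [sum_sharesR K hwfb κ hJ hFL] at hsum
  have hl : lhsPoly K.expand = lhsPoly K.toSymCert := rfl
  have hneg : (((K.gramR.flatMap blockUses).map negUse).map (useOp (envelope K.expand U).toList.toFinset)).sum =
      -((K.gramR.flatMap blockUses).map (useOp (envelope K.expand U).toList.toFinset)).sum := by
    rw [List.map_map, ← list_sum_map_neg]
    simp only [Function.comp_def, useOp_negUse]
  rw [hl, h2, List.map_append, List.sum_append, hneg, ← hsum]
  abel

/-- Twin of `energyDensity_ge_of_outroute` (OutRoute l.264): the closing a v1/E-class `Cert.lean` would cite. -/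
theorem energyDensity_ge_of_outrouteH (K : SymCertR) (hwf : wellFormed K.expand = true)
    (hRok : K.gramR.all (gramBlockROK K.frame) = true) (oracle : Word → HintT) (κ : Word → ℕ) (J : ℕ) (hJ : 0 < J)
    (hfacts : OutFactsH K oracle κ J 0 J) :
    ((symValueR K : ℚ) : ℝ) ≤ energyDensityTT' 1 0 8 (7 / 8) :=
  energyDensity_ge_of_windowSound_cert _ WardSlot.stub_wardWindowSound (wardD4CertGe_of_outrouteH K hwf hRok oracle κ J hJ hfacts)

/-! ## Box form (path of record for box frames, twin of OutRoute §«Box-canon form» / `…BoxCanon`): the licence test is the O(|w|)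
`inBox lo hi`, not a scan of the frame list; under `boxLicence frame lo hi` every box object IS the frame object. -/

def partnerOfB (lo hi : ℤ × ℤ) (h : HintT) (u : Word) : Option (DihedralGroup 4 × Site 2) :=
  match h.partner with
  | none => none
  | some p =>
    if inBox lo hi (moveWordV p.1 p.2 u) && polyNegEq (nfWord (moveWordV h.γ h.v u)) (nfWord (moveWordV p.1 p.2 u))
    then some p else none

def canonTermHWB (lo hi : ℤ × ℤ) (h : HintT) (t : ℚ × Word) : QPoly :=
  if inBox lo hi (moveWordV h.γ h.v t.2) then
    match partnerOfB lo hi h t.2 with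
    | some _ => []
    | none => pscale t.1 (nfWord (moveWordV h.γ h.v t.2))
  else [t]

def canonNFZHB (lo hi : ℤ × ℤ) (oracle : Word → HintT) (p : QPoly) : QPoly :=
  (dropZeros (collect (nfPoly p))).flatMap fun t => canonTermHWB lo hi (oracle t.2) t

def outOKHB (K : SymCertR) (oracle : Word → HintT) (κ : Word → ℕ) (J : ℕ) (lo hi : ℤ × ℤ) (i : ℕ) : Bool :=
  isZero (canonNFZHB lo hi oracle (shareR K κ J i))

def OutFactsHB (K : SymCertR) (oracle : Word → HintT) (κ : Word → ℕ) (J : ℕ) (lo hi : ℤ × ℤ) : ℕ → ℕ → Prop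
  | _, 0 => True
  | i, n + 1 => outOKHB K oracle κ J lo hi i = true ∧ OutFactsHB K oracle κ J lo hi (i + 1) n

theorem partnerOfB_eq {frame : List (Site 2)} {lo hi : ℤ × ℤ} (hb : boxLicence frame lo hi = true) (h : HintT) (u : Word) :
    partnerOfB lo hi h u = partnerOf frame h u := by
  unfold partnerOfB partnerOf
  simp only [moveWordV_eq, inBox_eq_suppIn hb]

theorem canonTermHWB_eq {frame : List (Site 2)} {lo hi : ℤ × ℤ} (hb : boxLicence frame lo hi = true) (h : HintT) (t : ℚ × Word) :
    canonTermHWB lo hi h t = canonTermHW frame h t := by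
  unfold canonTermHWB canonTermHW
  simp only [moveWordV_eq, inBox_eq_suppIn hb, partnerOfB_eq hb]

theorem canonNFZHB_eq {frame : List (Site 2)} {lo hi : ℤ × ℤ} (hb : boxLicence frame lo hi = true)
    (oracle : Word → HintT) (p : QPoly) : canonNFZHB lo hi oracle p = canonNFZH frame oracle p := by
  unfold canonNFZHB canonNFZH canonTermH
  simp only [canonTermHWB_eq hb]

theorem outOKHB_eq (K : SymCertR) (oracle : Word → HintT) (κ : Word → ℕ) (J : ℕ) {lo hi : ℤ × ℤ}
    (hb : boxLicence K.frame lo hi = true) (i : ℕ) : outOKHB K oracle κ J lo hi i = outOKH K oracle κ J i := by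
  rw [outOKHB, outOKH, canonNFZHB_eq hb]

theorem outFactsH_of_B (K : SymCertR) (oracle : Word → HintT) (κ : Word → ℕ) (J : ℕ) {lo hi : ℤ × ℤ}
    (hb : boxLicence K.frame lo hi = true) :
    ∀ (n i : ℕ), OutFactsHB K oracle κ J lo hi i n → OutFactsH K oracle κ J i n := by
  intro n
  induction n with
  | zero => intro i _; exact trivial
  | succ n ih => intro i hf; exact ⟨(outOKHB_eq K oracle κ J hb i).symm.trans hf.1, ih (i + 1) hf.2⟩

/-- **E5 closing, box form**: CLOSING GRAMMAR per module `i < J` one file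
`theorem out_i : outOKHB K oracle κ J lo hi i = true := by native_decide` (the oracle — e.g. sym-ref-1 g1's packed `canonPH` through
an adapter `Hint → HintT`, `k ↦ γof k`, `(amin, bmin) ↦ mkSite (−amin) (−bmin)` — runs INSIDE this evaluation; no hint data is shipped),
then `hfacts : OutFactsHB K oracle κ J lo hi 0 J := ⟨out_0, …, out_{J−1}, trivial⟩`. -/
theorem energyDensity_ge_of_outrouteHB (K : SymCertR) (hwf : wellFormed K.expand = true)
    (hRok : K.gramR.all (gramBlockROK K.frame) = true) (oracle : Word → HintT) (κ : Word → ℕ) (J : ℕ) (hJ : 0 < J)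
    (lo hi : ℤ × ℤ) (hbox : boxLicence K.frame lo hi = true) (hfacts : OutFactsHB K oracle κ J lo hi 0 J) :
    ((symValueR K : ℚ) : ℝ) ≤ energyDensityTT' 1 0 8 (7 / 8) :=
  energyDensity_ge_of_outrouteH K hwf hRok oracle κ J hJ (outFactsH_of_B K oracle κ J hbox J 0 hfacts)

/-! ## Toy: the hinted canon on one word with a hand hint (the verified step is the tree's `nfWord ∘ moveWordV`). -/
def w1 : Word := [⟨mkSite 1 0, 0, true⟩, ⟨mkSite 0 (-1), 0, false⟩]
/-- rotate by `r 1` and anchor at the box corner `(−12,−12)` : a licensed single image. -/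
def h1 : HintT := ⟨.r 1, mkSite (-11) (-12), none⟩
example : (inBox ((-12 : ℤ), (-12 : ℤ)) ((12 : ℤ), (12 : ℤ)) (moveWordV h1.γ h1.v w1)) = true := by decide +kernel
example : (canonTermHWB ((-12 : ℤ), (-12 : ℤ)) ((12 : ℤ), (12 : ℤ)) h1 ((3 : ℚ), w1)).length = 1 := by decide +kernel


/-! ## §RESORT — «RESORT = NF on block-shaped words» (= e5/ResortNF.lean): the verified step of E5 is `nfWord (moveWordV γ v u)` for a
NORMAL `u`; the moved word is block-shaped (`blockShaped_moveWordV`, via `d4Vec_injective`) and on block-shaped words the CAR normal-orderer performs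
NO contraction (`insL_cre`/`insL_ann`): `nfWord w = [resortNF w]` (`nfWord_eq_resortNF`), `resortNF` = signed two-block insertion sort over TREE
letters (sym-ref-1 g1's packed `sortPar` is its array twin; E4's packed re-sort is `resortNF` transported through `encW/decW`). -/

/-- Insert a letter into a `modeLt`-sorted block, counting the letters it passes (= transpositions). -/
def insP (x : Letter) : List Letter → List Letter × ℕ
  | [] => ([x], 0)
  | y :: ys => if x.modeLt y then (x :: y :: ys, 0) else let r := insP x ys; (y :: r.1, r.2 + 1)

/-- Insertion sort of a block by `modeLt`, right-to-left like `nfWord`, with the transposition count. -/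
def sortP : List Letter → List Letter × ℕ
  | [] => ([], 0)
  | x :: xs => let r := sortP xs; let r' := insP x r.1; (r'.1, r.2 + r'.2)

/-- `(−1)^n`. -/
def sgn (n : ℕ) : ℚ := if n % 2 = 0 then 1 else -1

/-- Signed two-block re-sort: `((−1)^(#transpositions), sorted creators ++ sorted annihilators)`. -/
def resortNF (w : Word) : ℚ × Word :=
  (sgn ((sortP (w.filter fun ℓ => ℓ.dag)).2 + (sortP (w.filter fun ℓ => !ℓ.dag)).2),
    (sortP (w.filter fun ℓ => ℓ.dag)).1 ++ (sortP (w.filter fun ℓ => !ℓ.dag)).1)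

/-- Block shape as a pairwise relation (cf. `NRel`/`Normal`): no creator after an annihilator, equal-dagger letters have distinct modes. -/
def BRel (a b : Letter) : Prop := (b.dag = true → a.dag = true) ∧ (a.dag = b.dag → a.modeEq b = false)

def BlockShaped (w : Word) : Prop := w.Pairwise BRel

/-- Executable test (for toys / a checker-side guard). -/
def brel (a b : Letter) : Bool := (!b.dag || a.dag) && (!(a.dag == b.dag) || !(a.modeEq b))

def blockShapedB : Word → Bool
  | [] => true
  | a :: w => (w.all fun b => brel a b) && blockShapedB w

theorem flatSite_eq (x : Site 2) : flatSite x = x := by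
  funext i; fin_cases i <;> rfl

/-- Moves are injective on modes. -/
theorem modeEq_move (γ : DihedralGroup 4) (v : Site 2) (a b : Letter) :
    (⟨flatSite (moveSite γ v a.x), a.s, a.dag⟩ : Letter).modeEq ⟨flatSite (moveSite γ v b.x), b.s, b.dag⟩ = a.modeEq b := by
  rw [Bool.eq_iff_iff]
  simp [Letter.modeEq, siteEq_iff, flatSite_eq, moveSite, d4R_eq_d4Vec, (d4Vec_injective γ).eq_iff]

/-- L1 (PROVED): a move of a normal word is block-shaped (moves keep daggers and are injective on modes). -/
theorem blockShaped_moveWordV (γ : DihedralGroup 4) (v : Site 2) (u : Word) (hu : Normal u) :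
    BlockShaped (moveWordV γ v u) := by
  rw [moveWordV_eq]
  unfold BlockShaped moveWordF
  rw [List.pairwise_map]
  refine List.Pairwise.imp (fun {a b} h => ?_) hu
  refine ⟨fun hb => ?_, fun hab => ?_⟩
  · cases ha : a.dag
    · have := (h.2 ha).1; simp_all
    · rfl
  · change a.dag = b.dag at hab
    rw [modeEq_move]
    have hlt : a.modeLt b = true := by
      cases ha : a.dag
      · exact (h.2 ha).2
      · exact h.1 ha (hab ▸ ha)
    cases he : a.modeEq b
    · rfl
    · exact absurd hlt (by simp [modeLt_irrefl_of_modeEq he])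

theorem sgn_zero : sgn 0 = 1 := by simp [sgn]

theorem sgn_succ (n : ℕ) : sgn (n + 1) = -sgn n := by
  by_cases h : n % 2 = 0
  · have h' : (n + 1) % 2 = 1 := by omega
    simp [sgn, h, h']
  · have h1 : n % 2 = 1 := by omega
    have h' : (n + 1) % 2 = 0 := by omega
    simp [sgn, h1, h']

theorem sgn_add (a : ℕ) : ∀ b : ℕ, sgn (a + b) = sgn a * sgn b
  | 0 => by simp [sgn_zero]
  | b + 1 => by rw [← Nat.add_assoc, sgn_succ, sgn_succ, sgn_add a b, mul_neg]

theorem mem_insP (m x : Letter) : ∀ l : List Letter, m ∈ (insP x l).1 ↔ m = x ∨ m ∈ l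
  | [] => by simp [insP]
  | y :: ys => by
    unfold insP
    split_ifs with h
    · simp
    · simp only [List.mem_cons, mem_insP m x ys]
      tauto

theorem mem_sortP (m : Letter) : ∀ l : List Letter, m ∈ (sortP l).1 ↔ m ∈ l
  | [] => by simp [sortP]
  | x :: xs => by
    unfold sortP
    simp only [mem_insP, mem_sortP m xs, List.mem_cons]

/-- `insL` of an ANNIHILATOR into an annihilator block with modes distinct from it: no contraction, signed insertion. -/
theorem insL_ann (ℓ : Letter) (hℓ : ℓ.dag = false) :
    ∀ (as : List Letter), (∀ m ∈ as, m.dag = false ∧ ℓ.modeEq m = false) →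
      insL ℓ as = [(sgn (insP ℓ as).2, (insP ℓ as).1)]
  | [], _ => by simp [insL, insP, sgn_zero]
  | m :: rest, h => by
    obtain ⟨hm, hme⟩ := h m List.mem_cons_self
    have ih := insL_ann ℓ hℓ rest fun m' hm' => h m' (List.mem_cons_of_mem _ hm')
    unfold insL insP
    simp only [hℓ, hm, hme, Bool.false_eq_true, if_false]
    split_ifs with hlt
    · simp [sgn_zero]
    · rw [ih, consNeg, List.map_cons, List.map_nil, sgn_succ]

/-- `insL` of a CREATOR into (creator block with modes distinct from it) ++ (annihilator block): signed insertion into the first block. -/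
theorem insL_cre (ℓ : Letter) (hℓ : ℓ.dag = true) :
    ∀ (cs as : List Letter), (∀ m ∈ cs, m.dag = true ∧ ℓ.modeEq m = false) → (∀ m ∈ as, m.dag = false) →
      insL ℓ (cs ++ as) = [(sgn (insP ℓ cs).2, (insP ℓ cs).1 ++ as)]
  | [], as, _, ha => by
    rcases as with _ | ⟨a, as'⟩
    · simp [insL, insP, sgn_zero]
    · have had : a.dag = false := ha a List.mem_cons_self
      simp [insL, insP, hℓ, had, sgn_zero]
  | m :: cs', as, hc, ha => by
    obtain ⟨hm, hme⟩ := hc m List.mem_cons_self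
    have ih := insL_cre ℓ hℓ cs' as (fun m' hm' => hc m' (List.mem_cons_of_mem _ hm')) ha
    rw [List.cons_append]
    unfold insL insP
    simp only [hℓ, hm, hme, Bool.false_eq_true, if_false, if_true]
    split_ifs with hlt
    · simp [sgn_zero]
    · rw [ih, consNeg, List.map_cons, List.map_nil, sgn_succ, List.cons_append]

theorem BlockShaped.tail {a : Letter} {w : Word} (h : BlockShaped (a :: w)) : BlockShaped w :=
  (List.pairwise_cons.1 h).2

theorem BlockShaped.rel {a : Letter} {w : Word} (h : BlockShaped (a :: w)) : ∀ b ∈ w, BRel a b :=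
  (List.pairwise_cons.1 h).1

/-- L2 (the `pnf_agree` core, PROVED): on a block-shaped word the normal-orderer is the signed two-block re-sort. -/
theorem nfWord_eq_resortNF : ∀ (w : Word), BlockShaped w → nfWord w = [resortNF w]
  | [], _ => by simp [nfWord, resortNF, sortP, sgn_zero]
  | ℓ :: w, hw => by
    have ih := nfWord_eq_resortNF w hw.tail
    have hrel := hw.rel
    rw [nfWord, ih, List.flatMap_cons, List.flatMap_nil, List.append_nil]
    -- the two blocks of `w`
    have hC : ∀ m ∈ (sortP (w.filter fun ℓ => ℓ.dag)).1, m.dag = true := fun m hm => by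
      have := (mem_sortP m _).1 hm; rw [List.mem_filter] at this; exact this.2
    have hA : ∀ m ∈ (sortP (w.filter fun ℓ => !ℓ.dag)).1, m.dag = false := fun m hm => by
      have := (mem_sortP m _).1 hm; rw [List.mem_filter] at this; simpa using this.2
    cases hd : ℓ.dag
    · -- annihilator: `w` has no creators
      have hw0 : ∀ b ∈ w, b.dag = false := fun b hb => by
        cases hb' : b.dag
        · rfl
        · exact absurd ((hrel b hb).1 hb') (by simp [hd])
      have hCnil : (w.filter fun ℓ => ℓ.dag) = [] := List.filter_eq_nil_iff.2 fun b hb => by simp [hw0 b hb]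
      have hA' : ∀ m ∈ (sortP (w.filter fun ℓ => !ℓ.dag)).1, m.dag = false ∧ ℓ.modeEq m = false := fun m hm =>
        ⟨hA m hm, by
          have hm' := (mem_sortP m _).1 hm; rw [List.mem_filter] at hm'
          exact (hrel m hm'.1).2 (by rw [hd, hA m hm])⟩
      have key := insL_ann ℓ hd _ hA'
      simp only [resortNF, hCnil, sortP, List.nil_append, Nat.zero_add] at key ⊢
      rw [key]
      simp only [List.map_cons, List.map_nil, List.filter_cons, hd, Bool.false_eq_true,
        Bool.not_false, hCnil, sortP, List.nil_append, Nat.zero_add, ite_true, ite_false]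
      rw [sgn_add]
    · -- creator
      have hC' : ∀ m ∈ (sortP (w.filter fun ℓ => ℓ.dag)).1, m.dag = true ∧ ℓ.modeEq m = false := fun m hm =>
        ⟨hC m hm, by
          have hm' := (mem_sortP m _).1 hm; rw [List.mem_filter] at hm'
          exact (hrel m hm'.1).2 (by rw [hd, hC m hm])⟩
      have key := insL_cre ℓ hd _ _ hC' hA
      simp only [resortNF] at key ⊢
      rw [key]
      simp only [List.map_cons, List.map_nil, List.filter_cons, hd, Bool.not_true, ite_true, ite_false,
        Bool.false_eq_true, sortP]
      refine List.cons_eq_cons.2 ⟨Prod.ext ?_ rfl, rfl⟩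
      simp only
      rw [Nat.add_right_comm]
      simp only [sgn_add]

/-- What E5 consumes: the verified image of a normal word under a move, computed by re-sorting. -/
theorem nfWord_moveWordV_eq_resortNF (γ : DihedralGroup 4) (v : Site 2) (u : Word) (hu : Normal u) :
    nfWord (moveWordV γ v u) = [resortNF (moveWordV γ v u)] :=
  nfWord_eq_resortNF _ (blockShaped_moveWordV γ v u hu)

/-! ## Toys (kernel evaluation): `nfWord w` vs `resortNF w` on moved normal words, incl. odd permutations and a same-mode `c† c` pair. -/
def agreeNR (w : Word) : Bool :=
  match nfWord w with
  | [t] => (t.1 == (resortNF w).1) && wordEq t.2 (resortNF w).2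
  | _ => false

def u1 : Word := [⟨mkSite (-1) 0, 0, true⟩, ⟨mkSite 1 1, 1, true⟩, ⟨mkSite 0 0, 0, false⟩, ⟨mkSite 2 (-1), 1, false⟩]
def u2 : Word := [⟨mkSite 0 0, 0, true⟩, ⟨mkSite 0 1, 1, true⟩, ⟨mkSite 3 2, 0, true⟩, ⟨mkSite 0 0, 0, false⟩, ⟨mkSite 0 1, 1, false⟩]
def u3 : Word := [⟨mkSite 2 2, 1, true⟩, ⟨mkSite (-2) 1, 0, false⟩]
example : (blockShapedB (moveWordV (.r 1) (mkSite 3 (-2)) u1) && blockShapedB (moveWordV (.sr 3) (mkSite 0 5) u2)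
    && blockShapedB (moveWordV (.r 2) 0 u3)) = true := by decide +kernel
example : (agreeNR (moveWordV (.r 1) (mkSite 3 (-2)) u1) && agreeNR (moveWordV (.sr 3) (mkSite 0 5) u2) && agreeNR (moveWordV (.r 2) 0 u3)
    && agreeNR (moveWordV (.sr 0) (mkSite 1 1) u2) && agreeNR (moveWordV (.r 3) (mkSite (-4) 4) u1)) = true := by decide +kernel
/-- and a NON-block-shaped word (annihilator before creator of the same mode) where a contraction occurs: `resortNF` must NOT be used there. -/
example : blockShapedB [⟨mkSite 0 0, 0, false⟩, ⟨mkSite 0 0, 0, true⟩] = false ∧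
    (nfWord [⟨mkSite 0 0, 0, false⟩, ⟨mkSite 0 0, 0, true⟩]).length = 2 := by decide +kernel


/-! ## §RESORT-EXEC — executable of record with the re-sort in place of `nfWord ∘ moveWordV` (equal as functions; closing rewritten) -/

/-- `nfWord` of a moved word computed by the signed two-block re-sort when the block-shape guard passes (always, on normal words), else by the tree. -/
def nfMoveR (γ : DihedralGroup 4) (v : Site 2) (u : Word) : QPoly :=
  if blockShapedB (moveWordV γ v u) then [resortNF (moveWordV γ v u)] else nfWord (moveWordV γ v u)

theorem brel_sound {a b : Letter} (h : brel a b = true) : BRel a b := by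
  cases ha : a.dag <;> cases hb : b.dag <;> cases he : a.modeEq b <;> simp_all [brel, BRel]

theorem blockShaped_of_B : ∀ {w : Word}, blockShapedB w = true → BlockShaped w
  | [], _ => List.Pairwise.nil
  | a :: w, h => by
    simp only [blockShapedB, Bool.and_eq_true, List.all_eq_true] at h
    exact List.pairwise_cons.2 ⟨fun b hb => brel_sound (h.1 b hb), blockShaped_of_B h.2⟩

theorem nfMoveR_eq (γ : DihedralGroup 4) (v : Site 2) (u : Word) : nfMoveR γ v u = nfWord (moveWordV γ v u) := by
  unfold nfMoveR
  split_ifs with h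
  · exact (nfWord_eq_resortNF _ (blockShaped_of_B h)).symm
  · rfl

def partnerOfBR (lo hi : ℤ × ℤ) (h : HintT) (u : Word) : Option (DihedralGroup 4 × Site 2) :=
  match h.partner with
  | none => none
  | some p =>
    if inBox lo hi (moveWordV p.1 p.2 u) && polyNegEq (nfMoveR h.γ h.v u) (nfMoveR p.1 p.2 u) then some p else none

def canonTermHWBR (lo hi : ℤ × ℤ) (h : HintT) (t : ℚ × Word) : QPoly :=
  if inBox lo hi (moveWordV h.γ h.v t.2) then
    match partnerOfBR lo hi h t.2 with
    | some _ => []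
    | none => pscale t.1 (nfMoveR h.γ h.v t.2)
  else [t]

def canonNFZHBR (lo hi : ℤ × ℤ) (oracle : Word → HintT) (p : QPoly) : QPoly :=
  (dropZeros (collect (nfPoly p))).flatMap fun t => canonTermHWBR lo hi (oracle t.2) t

def outOKHBR (K : SymCertR) (oracle : Word → HintT) (κ : Word → ℕ) (J : ℕ) (lo hi : ℤ × ℤ) (i : ℕ) : Bool :=
  isZero (canonNFZHBR lo hi oracle (shareR K κ J i))

def OutFactsHBR (K : SymCertR) (oracle : Word → HintT) (κ : Word → ℕ) (J : ℕ) (lo hi : ℤ × ℤ) : ℕ → ℕ → Prop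
  | _, 0 => True
  | i, n + 1 => outOKHBR K oracle κ J lo hi i = true ∧ OutFactsHBR K oracle κ J lo hi (i + 1) n

theorem partnerOfBR_eq (lo hi : ℤ × ℤ) (h : HintT) (u : Word) : partnerOfBR lo hi h u = partnerOfB lo hi h u := by
  unfold partnerOfBR partnerOfB
  simp only [nfMoveR_eq]

theorem canonTermHWBR_eq (lo hi : ℤ × ℤ) (h : HintT) (t : ℚ × Word) : canonTermHWBR lo hi h t = canonTermHWB lo hi h t := by
  unfold canonTermHWBR canonTermHWB
  simp only [nfMoveR_eq, partnerOfBR_eq]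

theorem canonNFZHBR_eq (lo hi : ℤ × ℤ) (oracle : Word → HintT) (p : QPoly) : canonNFZHBR lo hi oracle p = canonNFZHB lo hi oracle p := by
  unfold canonNFZHBR canonNFZHB
  simp only [canonTermHWBR_eq]

theorem outOKHBR_eq (K : SymCertR) (oracle : Word → HintT) (κ : Word → ℕ) (J : ℕ) (lo hi : ℤ × ℤ) (i : ℕ) :
    outOKHBR K oracle κ J lo hi i = outOKHB K oracle κ J lo hi i := by
  rw [outOKHBR, outOKHB, canonNFZHBR_eq]

theorem outFactsHB_of_R (K : SymCertR) (oracle : Word → HintT) (κ : Word → ℕ) (J : ℕ) (lo hi : ℤ × ℤ) :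
    ∀ (n i : ℕ), OutFactsHBR K oracle κ J lo hi i n → OutFactsHB K oracle κ J lo hi i n := by
  intro n
  induction n with
  | zero => intro i _; exact trivial
  | succ n ih => intro i hf; exact ⟨(outOKHBR_eq K oracle κ J lo hi i).symm.trans hf.1, ih (i + 1) hf.2⟩

/-- **E5 closing, box + re-sort form (executable of record, rev 2)**: per module `i < J` one file
`theorem out_i : outOKHBR K oracle κ J lo hi i = true := by native_decide`, then `hfacts := ⟨out_0, …, out_{J−1}, trivial⟩`. -/
theorem energyDensity_ge_of_outrouteHBR (K : SymCertR) (hwf : wellFormed K.expand = true)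
    (hRok : K.gramR.all (gramBlockROK K.frame) = true) (oracle : Word → HintT) (κ : Word → ℕ) (J : ℕ) (hJ : 0 < J)
    (lo hi : ℤ × ℤ) (hbox : boxLicence K.frame lo hi = true) (hfacts : OutFactsHBR K oracle κ J lo hi 0 J) :
    ((symValueR K : ℚ) : ℝ) ≤ energyDensityTT' 1 0 8 (7 / 8) :=
  energyDensity_ge_of_outrouteHB K hwf hRok oracle κ J hJ lo hi hbox (outFactsHB_of_R K oracle κ J lo hi J 0 hfacts)

/-! toy: the re-sort executable agrees with the `nfWord` executable on the hand-hinted word (semantic equality via `isZero ∘ collect ∘ psub`). -/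
example : isZero (collect (psub (canonTermHWBR ((-12 : ℤ), (-12 : ℤ)) ((12 : ℤ), (12 : ℤ)) h1 ((3 : ℚ), w1))
    (canonTermHWB ((-12 : ℤ), (-12 : ℤ)) ((12 : ℤ), (12 : ℤ)) h1 ((3 : ℚ), w1)))) = true ∧
    (canonTermHWBR ((-12 : ℤ), (-12 : ℤ)) ((12 : ℤ), (12 : ℤ)) h1 ((3 : ℚ), w1)).length = 1 := by decide +kernel
end Summit.Ventures.CertifiedManyBodySolver.Theorems.SymReplay.E5
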